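import Mathlib
import HarnessLib
import Summits.PneNP.PneNP.Theses.CnfIdealGenLength
import Literature.Computability.Complexity.BravermanPolylogFooling

/-!
# Crux `GenLengthSuperpoly` (stmt-PneNP-18879) — the TAME DECOUPLING split (strategist, sorry-free glue)

`GenLengthSuperpoly_of_subs : TameShortening → TameGenLengthSuperpoly → GenLengthSuperpoly` with the two
sub-cruxes stated INLINE (they are the registered stubs of `Cruxes/GenLengthSuperpoly/Lines/tame-decoupling.lean`
and the intended children of a `route edit --split GenLengthSuperpoly`):

* `TameShortening` (Sub₁, pure non-commutative algebra, the 2001-archive wall `W_TAME⁻`): for all exponents `a c`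
  there is `c'` such that eventually in `n`, every CNF `φ` over `Fin n` with `numClauses, size ≤ n^a` whose clause
  product has a two-sided representation through the Boolean/commutator axioms with `≤ n^c` terms and cofactor
  degree `≤ n^c` also has one with `≤ n^{c'}` terms, degree `≤ n^{c'}` and HANKEL-TAME cofactors of width `≤ n^{c'}`
  (coefficient function = weighted automaton `w ↦ α ⬝ᵥ (μ(w) *ᵥ β)`);
* `TameGenLengthSuperpoly` (Sub₂, the coefficient-sensitive core, logically weaker than the crux): some
  unsatisfiable poly-size CNF family has, for every `c`, eventually no such TAME representation with parameter `n^c`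
  (≈ non-commutative ABP-IPS with Boolean + commutator placeholders is not p-bounded on the family;
  Li–Tzameret–Wang, arXiv:1412.8746, §1 and Thm 1.4).

The proof is filter logic plus `eventually_eval_le_pow` (`p(n) ≤ n^{natDegree p + 1}` eventually), which turns the
family's polynomial size bound into the exponent `a` at which Sub₁ is invoked; Sub₁ carries separate exponents for
the CNF size and the representation so that no padding/monotonicity lemma for `HasBoundedRepr` is needed.
-/

set_option linter.dupNamespace false -- `Summit.PneNP.PneNP.…`: summit = sub-problem name (D-0017 single-conjunct layout)

namespace Summit.PneNP.PneNP.Theorems.CnfIdealGenLengthGenLengthSuperpolySplit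

open Filter
open Literature.Computability.Complexity
open Literature.Computability.MetaComplexity
open Summit.PneNP.PneNP.Theses.CnfIdealGenLength

/-- **Tame decoupling split of `GenLengthSuperpoly`.** `TameShortening → TameGenLengthSuperpoly → GenLengthSuperpoly`
(sub-cruxes inline; conclusion = the route decl BY NAME). For the family `(p, φ)` of Sub₂ and an exponent `c`, put
`a := natDegree p + 1` (`p(n) ≤ n^a` eventually) and take the `c'` of Sub₁ at `(a, c)`: eventually in `n` a
representation of `P_{φ n}` with `≤ n^c` terms and degree `≤ n^c` would yield a tame one with parameter `n^{c'}`,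
which Sub₂ at `c'` forbids. [cite: LiTzameretWang2018, §1.3.3 (ideal membership through the Boolean and commutator axioms)] [folklore filter logic] -/
theorem GenLengthSuperpoly_of_subs
    (h₁ : ∀ a c : ℕ, ∃ c' : ℕ, ∀ᶠ n : ℕ in atTop, ∀ φ : CNF (Fin n),
      CNF.numClauses φ ≤ n ^ a → CNF.size φ ≤ n ^ a →
        NCIPS.HasBoundedRepr ℚ (n ^ c) (n ^ c) φ →
          ∃ u g v : Fin (n ^ c') → MonoidAlgebra ℚ (FreeMonoid (Fin n)),
            (∀ ρ, NCIPS.IsAxiom (g ρ) ∧ NCIPS.wordDeg (u ρ) ≤ n ^ c' ∧ NCIPS.wordDeg (v ρ) ≤ n ^ c' ∧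
              (∃ (α β : Fin (n ^ c') → ℚ) (μ : Fin n → Matrix (Fin (n ^ c')) (Fin (n ^ c')) ℚ),
                ∀ w : FreeMonoid (Fin n),
                  (u ρ).coeff w = dotProduct α (Matrix.mulVec (FreeMonoid.lift μ w) β)) ∧
              (∃ (α β : Fin (n ^ c') → ℚ) (μ : Fin n → Matrix (Fin (n ^ c')) (Fin (n ^ c')) ℚ),
                ∀ w : FreeMonoid (Fin n),
                  (v ρ).coeff w = dotProduct α (Matrix.mulVec (FreeMonoid.lift μ w) β))) ∧
            ∑ ρ, u ρ * g ρ * v ρ = NCIPS.clauseProduct ℚ φ)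
    (h₂ : ∃ p : Polynomial ℕ, ∃ φ : (n : ℕ) → CNF (Fin n),
      (∀ n, ¬ (φ n).Satisfiable ∧ CNF.numClauses (φ n) ≤ p.eval n ∧ CNF.size (φ n) ≤ p.eval n) ∧
      ∀ c : ℕ, ∀ᶠ n : ℕ in atTop,
        ¬ ∃ u g v : Fin (n ^ c) → MonoidAlgebra ℚ (FreeMonoid (Fin n)),
            (∀ ρ, NCIPS.IsAxiom (g ρ) ∧ NCIPS.wordDeg (u ρ) ≤ n ^ c ∧ NCIPS.wordDeg (v ρ) ≤ n ^ c ∧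
              (∃ (α β : Fin (n ^ c) → ℚ) (μ : Fin n → Matrix (Fin (n ^ c)) (Fin (n ^ c)) ℚ),
                ∀ w : FreeMonoid (Fin n),
                  (u ρ).coeff w = dotProduct α (Matrix.mulVec (FreeMonoid.lift μ w) β)) ∧
              (∃ (α β : Fin (n ^ c) → ℚ) (μ : Fin n → Matrix (Fin (n ^ c)) (Fin (n ^ c)) ℚ),
                ∀ w : FreeMonoid (Fin n),
                  (v ρ).coeff w = dotProduct α (Matrix.mulVec (FreeMonoid.lift μ w) β))) ∧
            ∑ ρ, u ρ * g ρ * v ρ = NCIPS.clauseProduct ℚ (φ n)) :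
    GenLengthSuperpoly := by
  unfold GenLengthSuperpoly
  obtain ⟨p, φ, hgood, hbig⟩ := h₂
  refine ⟨p, φ, hgood, fun c => ?_⟩
  obtain ⟨c', hc'⟩ := h₁ (p.natDegree + 1) c
  filter_upwards [eventually_eval_le_pow p, hc', hbig c'] with n hn hsh hlb
  exact fun hB => hlb (hsh (φ n) ((hgood n).2.1.trans hn) ((hgood n).2.2.trans hn) hB)

end Summit.PneNP.PneNP.Theorems.CnfIdealGenLengthGenLengthSuperpolySplit
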